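import Summits.QuantumFields.BalabanUV.Beta.GAN24.FaceReadCrossedFromValues
import Summits.QuantumFields.BalabanUV.Beta.GAN24.FaceWordFullDeepPatterns

/-!
# `BalabanUV.Beta.GAN24.FaceReadCrossedValueDeep` (levels `≥ 1` twin of `FaceReadCrossedValueZero`: `0 ↦ j+1`, level-`j+1` FULL table AT THE W-LOCUS PINS `cE = Lc^{d+1}·wE`, `cVH = −½Lc^{2(d+1)}·wVH` — an INPUT, memo §5) — binder row G-an2-4 ∕ (CONV-C), W-slot (α-0), typer's PART VI row **T6-VAL**, the (γ) hand's letter **K7-0 AS A THEOREM ABOUT road-P2's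
# LITERAL**: **THE CROSSED VALUE OF THE LEVEL-0 FORCING's DEEP-PERIOD FACE READ** — for the level-0 dressed second-order source `c • mmRead Lc (K3OfK X̃♮₀ Lc S♮₀ M W) + cB • B` of road-P2
# (`X̃♮₀ = unitK sf sm (coDressKBmAt r Lc (KInvStep Lc 0))`, `S♮₀ = unitS sf sm (SpureRecAt d Lc r cE cVH cΛ 0)` the FULL level-0 stencil table, `M` any `Lc`-vertex family with F5 rows,
# `W = W2SymOfK X̃♮₀ Lc S♮₀ M 0 M₂`, `B` off the `inl/inl` block), the `LS`-symmetrised period-`P` face read on the CROSSED pattern `(a₀b₀;a₀b₀)`, `a₀ ≠ b₀` — leaf-02's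
# `ForcingFacePairFormAssembly.forcingPairForm_dressedStep` LHS at `(κ,κ′,κ₁,κ₂) = (a₀,b₀,a₀,b₀)`, WITHOUT its antisymmetry inputs `hL ∕ hR` — EQUALS
# `4 · (c·(−K₀²)) · K₀² · (Val(b₀,a₀;a₀,b₀) + Val(a₀,b₀;b₀,a₀))`, `K₀ = sf·sm·(stepScale d Lc 0 · Lc^{d+1})⁻¹`, `Val` = this hand's level-0 E-sector value (`FaceWordFullZero.faceWordFull_zero_value`:
# the `E2 d Lc 0`-cell pairing of K2's face profiles at period `Lc·P` minus `Lc^{2(d+1)}·` the `E2 d Lc 1` one at period `P`, with the unit∕amplitude prefactor `((sf·sm)⁻¹sf⁻²cE)²·(−¼)·sf²`).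
# This is `CrossedLedgerTelescope`'s `hface0` letter for road-P2's literal: the VH sector and the `W` word contribute NOTHING to the crossed value at level 0, and the count is `8 = 2 × 4`
# (G-an2-4 CRUX TEAM (2), seat `b2b-balaban-gan24-formalise-leaf-06` = the (γ) hand, gen 57; journal [GAN24LEAF06-G57-INTENT-6]; memo `g57/K7-ZERO-g57.md` §7)

NOT IN PRINT; OUR PROOF ([folklore] bookkeeping: `FaceReadCrossedFromValues.crossed_faceRead_of_values` at level `j+1` fed by the eight level-`j+1`
values∕zeros of `FaceWordFullZero.faceWordFull_zero_value`, `FaceWordFullZeroPatterns.faceWordFull_{zero_eq_zero_of_left_diag, swap_zero_value, swap_zero_eq_zero_of_left_diag}`; leaf-02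
Parts 44a∕46∕47∕50b `DressedVertexFacePush`, `FourFaceSourceWordsDeep.faceRead_dressedSource_inl_inl`, `FaceWWordVanishing.faceWWord_LS_eq_zero` BY NAME; 0 `def`, 0 cited fact, 0 `def … : Prop`,
0 sorry).  HONEST FRAMING (cell contract, verbatim): «discharging `BetaPertH` makes Bałaban's UV stability UNCONDITIONAL — a real constructive-QFT result; it is NOT the continuum limit and NOT
the Clay problem.»  HONEST DEPENDENCY (verbatim): «continuum YM on T⁴ ⇐ BetaPertH ∧ nine spine estimates (0/9 proved); BetaPertH ⇐ (D1) ∧ (D4) ∧ CAP+tail; G-an2-4 gates asym, D1 and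
NE2/3/4.»  WHAT THIS IS NOT: not `hXu` (leaf-03's `valLedger_all_iff_target_pin` wants the NUMBER `−4·Lc⁸·(Lc²P²−1)` at the pins: that needs the closed evaluation of `Val` — this hand's
`WilsonProfilePairing` for the `E2 d Lc 0` half, K2∕(Q-L) for the `E2 d Lc 1` half — NOT done here); the F5 rows of `S♮₀` and `M` (`hSrow`, `hMrow`) stay HYPOTHESES; discharges NOTHING of
`hX` ∕ (C) ∕ `hB0` ∕ `hBF` ∕ (Q-L); NEVER «G-an2-4 closed» as (CONV-C); NOT D1, NOT `BetaPertH`, NOT continuum, NOT Clay.  2026-08-24; no existing file touched.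
-/

noncomputable section

open Finset
open scoped BigOperators
open Literature.MathematicalPhysics.QuantumFieldTheory
open Literature.MathematicalPhysics.QuantumFieldTheory.Balaban1983to89
open Literature.MathematicalPhysics.QuantumFieldTheory.Balaban1983to89.Beta
open B12Sec2to5 (l1)
open ExpKernelCalculus (Site MKer Decays BiLoc VertexFamily VertexFamily₂ shiftK comp)
open OneStepResolventKernel (Fib LocStencil biLoc_mono)
open BalabanCompositeJets (LocStencil₂)
open AffineAveraging (box toSite)
open OneStepKernelFamily (KInvStep decays_KInvStep shiftK_KInvStep)
open SecondOrderResponse (dM K2OfK W2SymOfK LocStencilFM vertexFamily₂_W2SymOfK')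
open BalabanStepW2 (K3OfK)
open BalabanStepJetsSucc (mmRead)
open BalabanStepJets (locStencil_mono)
open Summit.QuantumFields.BalabanUV.Beta.TameKernelCalculus (Loc trK)
open Summit.QuantumFields.BalabanUV.Beta.BorderedHessian (stepScale sgnK)
open Summit.QuantumFields.BalabanUV.Beta.AxialDressingRooted (coDressKBmAt shiftK_coDressKBmAt decays_coDressKBmAt)
open Summit.QuantumFields.BalabanUV.Beta.HessKerDressedUnits (unitK decays_unitK)
open Summit.QuantumFields.BalabanUV.Beta.GAN24.BiStencilZeroMode (Tab)
open OneStepKernelFamily (KInvStep)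
open BalabanStepJetsSucc (E2 wVH)
open Summit.QuantumFields.BalabanUV.Beta.HessKerDressedUnits (unitS)
open Summit.QuantumFields.BalabanUV.Beta.SpineRooted (SpureRecAt)
open Summit.QuantumFields.BalabanUV.Beta.GAN24.FaceReadCrossedFromValues (crossed_faceRead_of_values)
open BalabanStepJetsSucc (wE)
open Summit.QuantumFields.BalabanUV.Beta.GAN24.FaceWordFullDeep (fullTableSucc_translate exists_common_rate_fullSucc faceWordFull_deep_value)
open Summit.QuantumFields.BalabanUV.Beta.GAN24.FaceWordFullDeepPatterns (faceWordFull_deep_eq_zero_of_left_diag faceWordFull_swap_deep_value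
  faceWordFull_swap_deep_eq_zero_of_left_diag)

namespace Summit.QuantumFields.BalabanUV.Beta.GAN24.FaceReadCrossedValueDeep

variable {d : ℕ} {Lc : ℕ} [NeZero Lc] {r : Fin (d + 1) → ℕ}

/-- NOT IN PRINT; OUR PROOF.  **THE CROSSED VALUE OF THE LEVEL-`j+1` FORCING's DEEP-PERIOD FACE READ (table at the W-locus pins)** (module docstring): road-P2's literal `LS`-symmetrised face read of the level-0 dressed
source at the crossed pattern `(a₀b₀;a₀b₀)` equals `4·(c·(−K₀²))·K₀²·(Val(b₀,a₀;a₀,b₀) + Val(a₀,b₀;b₀,a₀))`. -/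
theorem crossed_faceRead_dressedStep_deep (hLc : 1 ≤ Lc) (hr : r ∈ box (d + 1) Lc) {P : ℕ} (hP : 1 ≤ P) (sf sm cΛ : ℝ) (j : ℕ)
    {M : Fin (d + 1) → Site (d + 1) → MKer (d + 1) (Fib d)} {CM δM : ℝ} (hM : VertexFamily M Lc CM δM) (hδM : 0 < δM)
    (hMt : ∀ (ρ : Fin (d + 1)) (w t : Site (d + 1)), M ρ (w + t) = shiftK (-((Lc : ℤ) • t)) (M ρ w))
    (hSrow : ∀ κ u, trK ((unitS sf sm (SpureRecAt d Lc (toSite r) ((Lc : ℝ) ^ (d + 1)) (-((Lc : ℝ) ^ (d + 1) * (1 / 2) * (Lc : ℝ) ^ (d + 1))) cΛ (j + 1))) κ u) = -sgnK ((unitS sf sm (SpureRecAt d Lc (toSite r) ((Lc : ℝ) ^ (d + 1)) (-((Lc : ℝ) ^ (d + 1) * (1 / 2) * (Lc : ℝ) ^ (d + 1))) cΛ (j + 1))) κ u)) (hMrow : ∀ ρ w, trK (M ρ w) = -sgnK (M ρ w))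
    {M₂ : Fin (d + 1) → Site (d + 1) → Fin (d + 1) → Site (d + 1) → MKer (d + 1) (Fib d)} {C₂ δ₂ : ℝ} (hM₂ : LocStencilFM Lc M₂ C₂ δ₂) (hδ₂ : 0 < δ₂)
    (hM₂t : ∀ (κ : Fin (d + 1)) (u : Site (d + 1)) (ρ : Fin (d + 1)) (w t : Site (d + 1)), M₂ κ (u + (Lc : ℤ) • t) ρ (w + t) = shiftK (-((Lc : ℤ) • t)) (M₂ κ u ρ w))
    {B : Tab d} (hBff : ∀ κ u κ' u' x z (α β : Fin (d + 1)), B κ u κ' u' x z (Sum.inl α) (Sum.inl β) = 0) (c cB : ℝ)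
    {a₀ b₀ : Fin (d + 1)} (hab : a₀ ≠ b₀) :
        ((fun μ ν α β : Fin (d + 1) => ∑ r' ∈ box (d + 1) P, ∑' u' : Site (d + 1), ∑' x : Site (d + 1), ∑' z : Site (d + 1),
            (if toSite r' μ % (P : ℤ) = (P : ℤ) - 1 ∧ u' ν % (P : ℤ) = (P : ℤ) - 1 ∧ x α % (P : ℤ) = (P : ℤ) - 1 ∧ z β % (P : ℤ) = (P : ℤ) - 1 then
              (c • mmRead Lc (K3OfK (unitK sf sm (coDressKBmAt (toSite r) Lc (KInvStep (d := d) Lc (j + 1)))) Lc (unitS sf sm (SpureRecAt d Lc (toSite r) ((Lc : ℝ) ^ (d + 1)) (-((Lc : ℝ) ^ (d + 1) * (1 / 2) * (Lc : ℝ) ^ (d + 1))) cΛ (j + 1))) M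
                  (W2SymOfK (unitK sf sm (coDressKBmAt (toSite r) Lc (KInvStep (d := d) Lc (j + 1)))) Lc (unitS sf sm (SpureRecAt d Lc (toSite r) ((Lc : ℝ) ^ (d + 1)) (-((Lc : ℝ) ^ (d + 1) * (1 / 2) * (Lc : ℝ) ^ (d + 1))) cΛ (j + 1))) M 0 M₂) μ (toSite r') ν u')
                + cB • B μ (toSite r') ν u') x z (Sum.inl α) (Sum.inl β) else 0)) a₀ b₀ a₀ b₀
          + (fun μ ν α β : Fin (d + 1) => ∑ r' ∈ box (d + 1) P, ∑' u' : Site (d + 1), ∑' x : Site (d + 1), ∑' z : Site (d + 1),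
            (if toSite r' μ % (P : ℤ) = (P : ℤ) - 1 ∧ u' ν % (P : ℤ) = (P : ℤ) - 1 ∧ x α % (P : ℤ) = (P : ℤ) - 1 ∧ z β % (P : ℤ) = (P : ℤ) - 1 then
              (c • mmRead Lc (K3OfK (unitK sf sm (coDressKBmAt (toSite r) Lc (KInvStep (d := d) Lc (j + 1)))) Lc (unitS sf sm (SpureRecAt d Lc (toSite r) ((Lc : ℝ) ^ (d + 1)) (-((Lc : ℝ) ^ (d + 1) * (1 / 2) * (Lc : ℝ) ^ (d + 1))) cΛ (j + 1))) M
                  (W2SymOfK (unitK sf sm (coDressKBmAt (toSite r) Lc (KInvStep (d := d) Lc (j + 1)))) Lc (unitS sf sm (SpureRecAt d Lc (toSite r) ((Lc : ℝ) ^ (d + 1)) (-((Lc : ℝ) ^ (d + 1) * (1 / 2) * (Lc : ℝ) ^ (d + 1))) cΛ (j + 1))) M 0 M₂) μ (toSite r') ν u')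
                + cB • B μ (toSite r') ν u') x z (Sum.inl α) (Sum.inl β) else 0)) b₀ a₀ a₀ b₀)
        + ((fun μ ν α β : Fin (d + 1) => ∑ r' ∈ box (d + 1) P, ∑' u' : Site (d + 1), ∑' x : Site (d + 1), ∑' z : Site (d + 1),
            (if toSite r' μ % (P : ℤ) = (P : ℤ) - 1 ∧ u' ν % (P : ℤ) = (P : ℤ) - 1 ∧ x α % (P : ℤ) = (P : ℤ) - 1 ∧ z β % (P : ℤ) = (P : ℤ) - 1 then
              (c • mmRead Lc (K3OfK (unitK sf sm (coDressKBmAt (toSite r) Lc (KInvStep (d := d) Lc (j + 1)))) Lc (unitS sf sm (SpureRecAt d Lc (toSite r) ((Lc : ℝ) ^ (d + 1)) (-((Lc : ℝ) ^ (d + 1) * (1 / 2) * (Lc : ℝ) ^ (d + 1))) cΛ (j + 1))) M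
                  (W2SymOfK (unitK sf sm (coDressKBmAt (toSite r) Lc (KInvStep (d := d) Lc (j + 1)))) Lc (unitS sf sm (SpureRecAt d Lc (toSite r) ((Lc : ℝ) ^ (d + 1)) (-((Lc : ℝ) ^ (d + 1) * (1 / 2) * (Lc : ℝ) ^ (d + 1))) cΛ (j + 1))) M 0 M₂) μ (toSite r') ν u')
                + cB • B μ (toSite r') ν u') x z (Sum.inl α) (Sum.inl β) else 0)) b₀ a₀ a₀ b₀
          + (fun μ ν α β : Fin (d + 1) => ∑ r' ∈ box (d + 1) P, ∑' u' : Site (d + 1), ∑' x : Site (d + 1), ∑' z : Site (d + 1),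
            (if toSite r' μ % (P : ℤ) = (P : ℤ) - 1 ∧ u' ν % (P : ℤ) = (P : ℤ) - 1 ∧ x α % (P : ℤ) = (P : ℤ) - 1 ∧ z β % (P : ℤ) = (P : ℤ) - 1 then
              (c • mmRead Lc (K3OfK (unitK sf sm (coDressKBmAt (toSite r) Lc (KInvStep (d := d) Lc (j + 1)))) Lc (unitS sf sm (SpureRecAt d Lc (toSite r) ((Lc : ℝ) ^ (d + 1)) (-((Lc : ℝ) ^ (d + 1) * (1 / 2) * (Lc : ℝ) ^ (d + 1))) cΛ (j + 1))) M
                  (W2SymOfK (unitK sf sm (coDressKBmAt (toSite r) Lc (KInvStep (d := d) Lc (j + 1)))) Lc (unitS sf sm (SpureRecAt d Lc (toSite r) ((Lc : ℝ) ^ (d + 1)) (-((Lc : ℝ) ^ (d + 1) * (1 / 2) * (Lc : ℝ) ^ (d + 1))) cΛ (j + 1))) M 0 M₂) μ (toSite r') ν u')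
                + cB • B μ (toSite r') ν u') x z (Sum.inl α) (Sum.inl β) else 0)) a₀ b₀ a₀ b₀)
        + (((fun μ ν α β : Fin (d + 1) => ∑ r' ∈ box (d + 1) P, ∑' u' : Site (d + 1), ∑' x : Site (d + 1), ∑' z : Site (d + 1),
            (if toSite r' μ % (P : ℤ) = (P : ℤ) - 1 ∧ u' ν % (P : ℤ) = (P : ℤ) - 1 ∧ x α % (P : ℤ) = (P : ℤ) - 1 ∧ z β % (P : ℤ) = (P : ℤ) - 1 then
              (c • mmRead Lc (K3OfK (unitK sf sm (coDressKBmAt (toSite r) Lc (KInvStep (d := d) Lc (j + 1)))) Lc (unitS sf sm (SpureRecAt d Lc (toSite r) ((Lc : ℝ) ^ (d + 1)) (-((Lc : ℝ) ^ (d + 1) * (1 / 2) * (Lc : ℝ) ^ (d + 1))) cΛ (j + 1))) M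
                  (W2SymOfK (unitK sf sm (coDressKBmAt (toSite r) Lc (KInvStep (d := d) Lc (j + 1)))) Lc (unitS sf sm (SpureRecAt d Lc (toSite r) ((Lc : ℝ) ^ (d + 1)) (-((Lc : ℝ) ^ (d + 1) * (1 / 2) * (Lc : ℝ) ^ (d + 1))) cΛ (j + 1))) M 0 M₂) μ (toSite r') ν u')
                + cB • B μ (toSite r') ν u') x z (Sum.inl α) (Sum.inl β) else 0)) a₀ b₀ b₀ a₀
          + (fun μ ν α β : Fin (d + 1) => ∑ r' ∈ box (d + 1) P, ∑' u' : Site (d + 1), ∑' x : Site (d + 1), ∑' z : Site (d + 1),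
            (if toSite r' μ % (P : ℤ) = (P : ℤ) - 1 ∧ u' ν % (P : ℤ) = (P : ℤ) - 1 ∧ x α % (P : ℤ) = (P : ℤ) - 1 ∧ z β % (P : ℤ) = (P : ℤ) - 1 then
              (c • mmRead Lc (K3OfK (unitK sf sm (coDressKBmAt (toSite r) Lc (KInvStep (d := d) Lc (j + 1)))) Lc (unitS sf sm (SpureRecAt d Lc (toSite r) ((Lc : ℝ) ^ (d + 1)) (-((Lc : ℝ) ^ (d + 1) * (1 / 2) * (Lc : ℝ) ^ (d + 1))) cΛ (j + 1))) M
                  (W2SymOfK (unitK sf sm (coDressKBmAt (toSite r) Lc (KInvStep (d := d) Lc (j + 1)))) Lc (unitS sf sm (SpureRecAt d Lc (toSite r) ((Lc : ℝ) ^ (d + 1)) (-((Lc : ℝ) ^ (d + 1) * (1 / 2) * (Lc : ℝ) ^ (d + 1))) cΛ (j + 1))) M 0 M₂) μ (toSite r') ν u')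
                + cB • B μ (toSite r') ν u') x z (Sum.inl α) (Sum.inl β) else 0)) b₀ a₀ b₀ a₀)
        + ((fun μ ν α β : Fin (d + 1) => ∑ r' ∈ box (d + 1) P, ∑' u' : Site (d + 1), ∑' x : Site (d + 1), ∑' z : Site (d + 1),
            (if toSite r' μ % (P : ℤ) = (P : ℤ) - 1 ∧ u' ν % (P : ℤ) = (P : ℤ) - 1 ∧ x α % (P : ℤ) = (P : ℤ) - 1 ∧ z β % (P : ℤ) = (P : ℤ) - 1 then
              (c • mmRead Lc (K3OfK (unitK sf sm (coDressKBmAt (toSite r) Lc (KInvStep (d := d) Lc (j + 1)))) Lc (unitS sf sm (SpureRecAt d Lc (toSite r) ((Lc : ℝ) ^ (d + 1)) (-((Lc : ℝ) ^ (d + 1) * (1 / 2) * (Lc : ℝ) ^ (d + 1))) cΛ (j + 1))) M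
                  (W2SymOfK (unitK sf sm (coDressKBmAt (toSite r) Lc (KInvStep (d := d) Lc (j + 1)))) Lc (unitS sf sm (SpureRecAt d Lc (toSite r) ((Lc : ℝ) ^ (d + 1)) (-((Lc : ℝ) ^ (d + 1) * (1 / 2) * (Lc : ℝ) ^ (d + 1))) cΛ (j + 1))) M 0 M₂) μ (toSite r') ν u')
                + cB • B μ (toSite r') ν u') x z (Sum.inl α) (Sum.inl β) else 0)) b₀ a₀ b₀ a₀
          + (fun μ ν α β : Fin (d + 1) => ∑ r' ∈ box (d + 1) P, ∑' u' : Site (d + 1), ∑' x : Site (d + 1), ∑' z : Site (d + 1),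
            (if toSite r' μ % (P : ℤ) = (P : ℤ) - 1 ∧ u' ν % (P : ℤ) = (P : ℤ) - 1 ∧ x α % (P : ℤ) = (P : ℤ) - 1 ∧ z β % (P : ℤ) = (P : ℤ) - 1 then
              (c • mmRead Lc (K3OfK (unitK sf sm (coDressKBmAt (toSite r) Lc (KInvStep (d := d) Lc (j + 1)))) Lc (unitS sf sm (SpureRecAt d Lc (toSite r) ((Lc : ℝ) ^ (d + 1)) (-((Lc : ℝ) ^ (d + 1) * (1 / 2) * (Lc : ℝ) ^ (d + 1))) cΛ (j + 1))) M
                  (W2SymOfK (unitK sf sm (coDressKBmAt (toSite r) Lc (KInvStep (d := d) Lc (j + 1)))) Lc (unitS sf sm (SpureRecAt d Lc (toSite r) ((Lc : ℝ) ^ (d + 1)) (-((Lc : ℝ) ^ (d + 1) * (1 / 2) * (Lc : ℝ) ^ (d + 1))) cΛ (j + 1))) M 0 M₂) μ (toSite r') ν u')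
                + cB • B μ (toSite r') ν u') x z (Sum.inl α) (Sum.inl β) else 0)) a₀ b₀ b₀ a₀))
          = 4 * ((c * -(((sf * sm) * (stepScale d Lc (j + 1) * (Lc : ℝ) ^ (d + 1))⁻¹) * ((sf * sm) * (stepScale d Lc (j + 1) * (Lc : ℝ) ^ (d + 1))⁻¹))) * (((sf * sm) * (stepScale d Lc (j + 1) * (Lc : ℝ) ^ (d + 1))⁻¹) * ((sf * sm) * (stepScale d Lc (j + 1) * (Lc : ℝ) ^ (d + 1))⁻¹))) *
            ((((sf * sm)⁻¹ * (sf⁻¹ * sf⁻¹) * ((Lc : ℝ) ^ (d + 1) * wE d Lc (j + 1))) * ((sf * sm)⁻¹ * (sf⁻¹ * sf⁻¹) * ((Lc : ℝ) ^ (d + 1) * wE d Lc (j + 1)))) *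
      ((-(1 / 2 : ℝ)) * (1 / 2 : ℝ) * ((sf * sf) *
        ((wVH d Lc (j + 1))⁻¹ *
            ∑ x ∈ box (d + 1) (Lc * P), ∑ b : Fin (d + 1),
              ((if b = b₀ then ((((Lc * P : ℕ) : ℝ))⁻¹ * (((Lc * P : ℕ) : ℝ))⁻¹) * ((((toSite x a₀ % ((Lc * P : ℕ) : ℤ) : ℤ) : ℝ) - ((((Lc * P : ℕ) : ℝ)) - 1) / 2)) else 0)
                + (if b = a₀ then (-(((Lc * P : ℕ) : ℝ))⁻¹ * ((((toSite x b₀ % ((Lc * P : ℕ) : ℤ) : ℤ) : ℝ) - ((((Lc * P : ℕ) : ℝ)) - 1) / 2))) *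
                    (if toSite x a₀ % ((Lc * P : ℕ) : ℤ) = ((Lc * P : ℕ) : ℤ) - 1 then (1 : ℝ) else 0) else 0)) *
              ∑' s : Site (d + 1), ∑ b' : Fin (d + 1), E2 d Lc (j + 1) (toSite x) s (Sum.inl b) (Sum.inl b') *
                ((if b' = a₀ then ((((Lc * P : ℕ) : ℝ))⁻¹ * (((Lc * P : ℕ) : ℝ))⁻¹) * ((((s b₀ % ((Lc * P : ℕ) : ℤ) : ℤ) : ℝ) - ((((Lc * P : ℕ) : ℝ)) - 1) / 2)) else 0)
                  + (if b' = b₀ then (-(((Lc * P : ℕ) : ℝ))⁻¹ * ((((s a₀ % ((Lc * P : ℕ) : ℤ) : ℤ) : ℝ) - ((((Lc * P : ℕ) : ℝ)) - 1) / 2))) *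
                      (if s b₀ % ((Lc * P : ℕ) : ℤ) = ((Lc * P : ℕ) : ℤ) - 1 then (1 : ℝ) else 0) else 0)) -
          (wVH d Lc (j + 1))⁻¹ * (((Lc : ℝ) ^ (d + 1) * (Lc : ℝ) ^ (d + 1)) *
            ∑ y ∈ box (d + 1) P, ∑ a : Fin (d + 1),
              ((if a = b₀ then (((P : ℝ))⁻¹ * ((P : ℝ))⁻¹) * ((((toSite y a₀ % (P : ℤ)) : ℤ) : ℝ) - ((P : ℝ) - 1) / 2) else 0)
                + (if a = a₀ then (-((P : ℝ))⁻¹ * ((((toSite y b₀ % (P : ℤ)) : ℤ) : ℝ) - ((P : ℝ) - 1) / 2)) *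
                    (if toSite y a₀ % (P : ℤ) = (P : ℤ) - 1 then (1 : ℝ) else 0) else 0)) *
              ∑' s : Site (d + 1), ∑ b' : Fin (d + 1), E2 d Lc (j + 2) (toSite y) s (Sum.inl a) (Sum.inl b') *
                ((if b' = a₀ then (((P : ℝ))⁻¹ * ((P : ℝ))⁻¹) * ((((s b₀ % (P : ℤ)) : ℤ) : ℝ) - ((P : ℝ) - 1) / 2) else 0)
                  + (if b' = b₀ then (-((P : ℝ))⁻¹ * ((((s a₀ % (P : ℤ)) : ℤ) : ℝ) - ((P : ℝ) - 1) / 2)) *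
                      (if s b₀ % (P : ℤ) = (P : ℤ) - 1 then (1 : ℝ) else 0) else 0))))))
            + (((sf * sm)⁻¹ * (sf⁻¹ * sf⁻¹) * ((Lc : ℝ) ^ (d + 1) * wE d Lc (j + 1))) * ((sf * sm)⁻¹ * (sf⁻¹ * sf⁻¹) * ((Lc : ℝ) ^ (d + 1) * wE d Lc (j + 1)))) *
      ((-(1 / 2 : ℝ)) * (1 / 2 : ℝ) * ((sf * sf) *
        ((wVH d Lc (j + 1))⁻¹ *
            ∑ x ∈ box (d + 1) (Lc * P), ∑ b : Fin (d + 1),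
              ((if b = a₀ then ((((Lc * P : ℕ) : ℝ))⁻¹ * (((Lc * P : ℕ) : ℝ))⁻¹) * ((((toSite x b₀ % ((Lc * P : ℕ) : ℤ) : ℤ) : ℝ) - ((((Lc * P : ℕ) : ℝ)) - 1) / 2)) else 0)
                + (if b = b₀ then (-(((Lc * P : ℕ) : ℝ))⁻¹ * ((((toSite x a₀ % ((Lc * P : ℕ) : ℤ) : ℤ) : ℝ) - ((((Lc * P : ℕ) : ℝ)) - 1) / 2))) *
                    (if toSite x b₀ % ((Lc * P : ℕ) : ℤ) = ((Lc * P : ℕ) : ℤ) - 1 then (1 : ℝ) else 0) else 0)) *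
              ∑' s : Site (d + 1), ∑ b' : Fin (d + 1), E2 d Lc (j + 1) (toSite x) s (Sum.inl b) (Sum.inl b') *
                ((if b' = b₀ then ((((Lc * P : ℕ) : ℝ))⁻¹ * (((Lc * P : ℕ) : ℝ))⁻¹) * ((((s a₀ % ((Lc * P : ℕ) : ℤ) : ℤ) : ℝ) - ((((Lc * P : ℕ) : ℝ)) - 1) / 2)) else 0)
                  + (if b' = a₀ then (-(((Lc * P : ℕ) : ℝ))⁻¹ * ((((s b₀ % ((Lc * P : ℕ) : ℤ) : ℤ) : ℝ) - ((((Lc * P : ℕ) : ℝ)) - 1) / 2))) *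
                      (if s a₀ % ((Lc * P : ℕ) : ℤ) = ((Lc * P : ℕ) : ℤ) - 1 then (1 : ℝ) else 0) else 0)) -
          (wVH d Lc (j + 1))⁻¹ * (((Lc : ℝ) ^ (d + 1) * (Lc : ℝ) ^ (d + 1)) *
            ∑ y ∈ box (d + 1) P, ∑ a : Fin (d + 1),
              ((if a = a₀ then (((P : ℝ))⁻¹ * ((P : ℝ))⁻¹) * ((((toSite y b₀ % (P : ℤ)) : ℤ) : ℝ) - ((P : ℝ) - 1) / 2) else 0)
                + (if a = b₀ then (-((P : ℝ))⁻¹ * ((((toSite y a₀ % (P : ℤ)) : ℤ) : ℝ) - ((P : ℝ) - 1) / 2)) *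
                    (if toSite y b₀ % (P : ℤ) = (P : ℤ) - 1 then (1 : ℝ) else 0) else 0)) *
              ∑' s : Site (d + 1), ∑ b' : Fin (d + 1), E2 d Lc (j + 2) (toSite y) s (Sum.inl a) (Sum.inl b') *
                ((if b' = b₀ then (((P : ℝ))⁻¹ * ((P : ℝ))⁻¹) * ((((s a₀ % (P : ℤ)) : ℤ) : ℝ) - ((P : ℝ) - 1) / 2) else 0)
                  + (if b' = a₀ then (-((P : ℝ))⁻¹ * ((((s b₀ % (P : ℤ)) : ℤ) : ℝ) - ((P : ℝ) - 1) / 2)) *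
                      (if s a₀ % (P : ℤ) = (P : ℤ) - 1 then (1 : ℝ) else 0) else 0))))))) := by
  haveI : NeZero P := ⟨by omega⟩
  obtain ⟨Cs, _C₁, _C₂, _CX, δs, hδs, hS, _hrest⟩ := exists_common_rate_fullSucc (d := d) hr sf sm cΛ j
  exact crossed_faceRead_of_values (d := d) hLc hr hP sf sm (j + 1) hS hδs hM hδM
    (fun κ u t => fullTableSucc_translate (d := d) (r := r) sf sm cΛ j κ u t) hMt hSrow hMrow hM₂ hδ₂ hM₂t hBff c cB
    (faceWordFull_deep_value (d := d) hr sf sm cΛ j P hab.symm hab)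
    (faceWordFull_deep_value (d := d) hr sf sm cΛ j P hab hab.symm)
    (faceWordFull_deep_eq_zero_of_left_diag (d := d) hr sf sm cΛ j P a₀ b₀ b₀)
    (faceWordFull_deep_eq_zero_of_left_diag (d := d) hr sf sm cΛ j P b₀ a₀ a₀)
    (faceWordFull_swap_deep_value (d := d) hr sf sm cΛ j P hab.symm hab)
    (faceWordFull_swap_deep_value (d := d) hr sf sm cΛ j P hab hab.symm)
    (faceWordFull_swap_deep_eq_zero_of_left_diag (d := d) hr sf sm cΛ j P b₀ a₀ b₀)
    (faceWordFull_swap_deep_eq_zero_of_left_diag (d := d) hr sf sm cΛ j P a₀ b₀ a₀)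

end Summit.QuantumFields.BalabanUV.Beta.GAN24.FaceReadCrossedValueDeep

end
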